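import Summits.AtomisticToContinuum.Crystallization.Theorems.ExcessDecayLiouvillePhononStabilityCertBlochDefs
import Mathlib.Analysis.Convex.Deriv
import Mathlib.Analysis.Complex.RealDeriv
import Mathlib.Analysis.SpecialFunctions.ExpDeriv

/-!
# Near-certificate layer B3-a: the one-frequency model of a Bloch-symbol entry (lead c3, skeleton v10)

Support file for crux `PhononStability` (stmt-AtomisticToContinuum-9333), line `contragredient-window-collapse`;
helper of `…CertBlochCurv` (`stub_certBlochCurv2`, slice concavity of the symbol form).

Along a path `t ↦ z t` of the phase torus on which the phase monomial of a class `c = (m, m', n)` is a unimodular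
exponential `zⁿ = e^{iνt} · P` (`|P| = 1`), the entry `Re cbil M (Δ_c a) (Δ_c a)` of the symbol form is
`A − Re (β e^{iνt})` with `|β| ≤ |cbil M aₘ aₘ'| + |cbil M aₘ' aₘ| ≤ absSum M · (|aₘ|² + |aₘ'|²)` (`re_cbil_expand`,
`norm_cbil_le`), and the model `A − Re (β e^{iνt}) − (C/2) t²` is concave as soon as `ν² |β| ≤ C`
(`concaveOn_model`, second-derivative test `concaveOn_of_hasDerivWithinAt2_nonpos`).  The slice-curvature constant
`curvQ2` carries the weight `κ = 2` on same-sublattice classes (`|aₘ|² + |aₘ|² ≤ 2 Σ|a|²`) and `κ = 1` otherwise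
(`|aₘ|² + |aₘ'|²` is then exactly `Σ|a|²`, `sliceNormSq_le`). [folklore]
-/

noncomputable section

open scoped BigOperators Classical ComplexConjugate
open Set Function

namespace Summit.AtomisticToContinuum.Crystallization.Theorems.PhononStabilityCWC.Cert

/-! ## The slice-curvature constant -/

/-- Slice-curvature constant of the symbol form in the direction `θᵢ`:
`Σ_{(c,M) ∈ L} κ(c) · nᵢ(c)² · absSum M` with `κ = 2` for a same-sublattice class (`m = m'`) and `κ = 1`
otherwise; times `Σ|a|²` it dominates `∂²_{θᵢ}` of the symbol form. [folklore] -/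
def curvQ2 (L : List (BondClass × Mat)) (i : Fin 3) : ℚ :=
  (L.map fun e => (if e.1.1 = e.1.2.1 then (2:ℚ) else 1) * ((e.1.2.2 i : ℚ) ^ 2) * absSum e.2).sum

/-- `absSum ≥ 0`. [folklore] -/
theorem absSum_nonneg (M : Mat) : 0 ≤ absSum M :=
  Finset.sum_nonneg fun _ _ => Finset.sum_nonneg fun _ _ => abs_nonneg _

/-- `curvQ2 ≥ 0`. [folklore] -/
theorem curvQ2_nonneg (L : List (BondClass × Mat)) (i : Fin 3) : 0 ≤ curvQ2 L i := by
  unfold curvQ2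
  refine List.sum_nonneg ?_
  intro q hq
  rw [List.mem_map] at hq
  obtain ⟨e, -, rfl⟩ := hq
  have h1 : 0 ≤ absSum e.2 := absSum_nonneg e.2
  have h2 : (0 : ℚ) ≤ (if e.1.1 = e.1.2.1 then (2 : ℚ) else 1) := by split_ifs <;> norm_num
  positivity

/-- `curvQ2` of a cons. [folklore] -/
theorem curvQ2_cons (e : BondClass × Mat) (L : List (BondClass × Mat)) (i : Fin 3) :
    curvQ2 (e :: L) i =
      (if e.1.1 = e.1.2.1 then (2:ℚ) else 1) * ((e.1.2.2 i : ℚ) ^ 2) * absSum e.2 + curvQ2 L i := by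
  simp [curvQ2]

/-- `symbolForm` of a cons. [folklore] -/
theorem symbolForm_cons (e : BondClass × Mat) (L : List (BondClass × Mat)) (z : Fin 3 → ℂ)
    (a : Fin 2 → Fin 3 → ℂ) :
    symbolForm (e :: L) z a = (cbil e.2 (blochDiff e.1 z a) (blochDiff e.1 z a)).re + symbolForm L z a := by
  simp [symbolForm]

/-! ## Algebra of the sesquilinear form -/

/-- Expansion of `cbil M (φ y − x) (φ y − x)`. [folklore] -/
theorem cbil_expand (M : Mat) (φ : ℂ) (x y : Fin 3 → ℂ) :
    cbil M (fun k => φ * y k - x k) (fun k => φ * y k - x k) =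
      conj φ * φ * cbil M y y + cbil M x x - conj φ * cbil M y x - φ * cbil M x y := by
  simp only [cbil, Finset.mul_sum, ← Finset.sum_add_distrib, ← Finset.sum_sub_distrib]
  refine Finset.sum_congr rfl fun k _ => Finset.sum_congr rfl fun l _ => ?_
  simp only [map_sub, map_mul]
  ring

/-- Real part of an entry of the symbol form at a unimodular phase:
`Re cbil M (φ y − x) (φ y − x) = Re (cbil M y y + cbil M x x) − Re (φ · (conj (cbil M y x) + cbil M x y))`.
[folklore] -/
theorem re_cbil_expand (M : Mat) {φ : ℂ} (hφ : ‖φ‖ = 1) (x y : Fin 3 → ℂ) :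
    (cbil M (fun k => φ * y k - x k) (fun k => φ * y k - x k)).re =
      (cbil M y y + cbil M x x).re - (φ * (conj (cbil M y x) + cbil M x y)).re := by
  rw [cbil_expand]
  have h1 : conj φ * φ = 1 := by
    rw [Complex.conj_mul', hφ]
    simp
  rw [h1, one_mul]
  simp only [Complex.sub_re, Complex.add_re, Complex.mul_re, Complex.conj_re, Complex.conj_im, Complex.add_im]
  ring

/-- `|cbil M x y| ≤ absSum M · (|x|² + |y|²)/2`. [folklore] -/
theorem norm_cbil_le (M : Mat) (x y : Fin 3 → ℂ) :
    ‖cbil M x y‖ ≤ (absSum M : ℝ) * (((∑ k, ‖x k‖ ^ 2) + ∑ k, ‖y k‖ ^ 2) / 2) := by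
  have hS : ∀ k l, ‖x k‖ * ‖y l‖ ≤ ((∑ k, ‖x k‖ ^ 2) + ∑ k, ‖y k‖ ^ 2) / 2 := by
    intro k l
    have hx : ‖x k‖ ^ 2 ≤ ∑ k, ‖x k‖ ^ 2 :=
      Finset.single_le_sum (fun k _ => sq_nonneg ‖x k‖) (Finset.mem_univ k)
    have hy : ‖y l‖ ^ 2 ≤ ∑ k, ‖y k‖ ^ 2 :=
      Finset.single_le_sum (fun k _ => sq_nonneg ‖y k‖) (Finset.mem_univ l)
    nlinarith [two_mul_le_add_sq ‖x k‖ ‖y l‖]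
  unfold cbil absSum
  push_cast
  calc ‖∑ k, ∑ l, (M k l : ℂ) * conj (x k) * y l‖
      ≤ ∑ k, ‖∑ l, (M k l : ℂ) * conj (x k) * y l‖ := norm_sum_le _ _
    _ ≤ ∑ k, ∑ l, ‖(M k l : ℂ) * conj (x k) * y l‖ := Finset.sum_le_sum fun k _ => norm_sum_le _ _
    _ ≤ ∑ k, ∑ l, |(M k l : ℝ)| * (((∑ k, ‖x k‖ ^ 2) + ∑ k, ‖y k‖ ^ 2) / 2) := by
        refine Finset.sum_le_sum fun k _ => Finset.sum_le_sum fun l _ => ?_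
        rw [norm_mul, norm_mul, Complex.norm_conj, Complex.norm_ratCast, mul_assoc]
        exact mul_le_mul_of_nonneg_left (hS k l) (abs_nonneg _)
    _ = (∑ k, ∑ l, |(M k l : ℝ)|) * (((∑ k, ‖x k‖ ^ 2) + ∑ k, ‖y k‖ ^ 2) / 2) := by
        rw [Finset.sum_mul]
        refine Finset.sum_congr rfl fun k _ => ?_
        rw [Finset.sum_mul]

/-- The two sublattice amplitude norms of a class are dominated by `κ · Σ|a|²` (`κ = 2` if `m = m'`, else the two
amplitudes are the two distinct summands of `Σ|a|²`). [folklore] -/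
theorem sliceNormSq_le (a : Fin 2 → Fin 3 → ℂ) (m m' : Fin 2) :
    (∑ k, ‖a m k‖ ^ 2) + ∑ k, ‖a m' k‖ ^ 2 ≤ (if m = m' then (2:ℝ) else 1) * ∑ j, ∑ k, ‖a j k‖ ^ 2 := by
  have hle : ∀ j : Fin 2, ∑ k, ‖a j k‖ ^ 2 ≤ ∑ j, ∑ k, ‖a j k‖ ^ 2 := fun j =>
    Finset.single_le_sum (f := fun j => ∑ k, ‖a j k‖ ^ 2)
      (fun j _ => Finset.sum_nonneg fun k _ => sq_nonneg ‖a j k‖) (Finset.mem_univ j)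
  by_cases h : m = m'
  · subst h
    rw [if_pos rfl]
    linarith [hle m]
  · rw [if_neg h, one_mul]
    refine le_of_eq ?_
    fin_cases m <;> fin_cases m' <;> simp [Fin.sum_univ_two, add_comm] at h ⊢

/-! ## The one-frequency model -/

/-- Derivative of `t ↦ Re (β · e^{iνt})`. [folklore] -/
theorem hasDerivAt_re_mul_cexp (β : ℂ) (ν t : ℝ) :
    HasDerivAt (fun s : ℝ => (β * Complex.exp ((ν : ℂ) * ((s : ℂ) * Complex.I))).re)
      ((β * ((ν : ℂ) * Complex.I) * Complex.exp ((ν : ℂ) * ((t : ℂ) * Complex.I))).re) t := by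
  have h1 : HasDerivAt (fun w : ℂ => (ν : ℂ) * (w * Complex.I)) ((ν : ℂ) * Complex.I) (t : ℂ) := by
    simpa using ((hasDerivAt_id (t : ℂ)).mul_const Complex.I).const_mul (ν : ℂ)
  have h2 := (h1.cexp.const_mul β).real_of_complex
  convert h2 using 2
  ring

/-- `|e^{iνt}| = 1`. [folklore] -/
theorem norm_cexp_slice (ν t : ℝ) : ‖Complex.exp ((ν : ℂ) * ((t : ℂ) * Complex.I))‖ = 1 := by
  rw [show ((ν : ℂ) * ((t : ℂ) * Complex.I)) = ((ν * t : ℝ) : ℂ) * Complex.I by push_cast; ring]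
  exact Complex.norm_exp_ofReal_mul_I _

/-- **The one-frequency model is concave:** `t ↦ A − Re (β e^{iνt}) − (C/2) t²` is concave on `ℝ` whenever
`ν² |β| ≤ C` (second-derivative test). [folklore] -/
theorem concaveOn_model (A C ν : ℝ) (β : ℂ) (hC : ν ^ 2 * ‖β‖ ≤ C) :
    ConcaveOn ℝ Set.univ
      (fun t : ℝ => A - (β * Complex.exp ((ν : ℂ) * ((t : ℂ) * Complex.I))).re - C / 2 * t ^ 2) := by
  have hsq : ∀ t : ℝ, HasDerivAt (fun s : ℝ => C / 2 * s ^ 2) (C * t) t := fun t => by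
    refine ((hasDerivAt_pow 2 t).const_mul (C / 2)).congr_deriv ?_
    rw [show (2 - 1 : ℕ) = 1 from rfl, pow_one]
    push_cast
    ring
  have hd1 : ∀ t : ℝ, HasDerivAt
      (fun s : ℝ => A - (β * Complex.exp ((ν : ℂ) * ((s : ℂ) * Complex.I))).re - C / 2 * s ^ 2)
      (0 - (β * ((ν : ℂ) * Complex.I) * Complex.exp ((ν : ℂ) * ((t : ℂ) * Complex.I))).re - C * t) t :=
    fun t => ((hasDerivAt_const t A).sub (hasDerivAt_re_mul_cexp β ν t)).sub (hsq t)
  have hd2 : ∀ t : ℝ, HasDerivAt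
      (fun s : ℝ => 0 - (β * ((ν : ℂ) * Complex.I) * Complex.exp ((ν : ℂ) * ((s : ℂ) * Complex.I))).re - C * s)
      (0 - (β * ((ν : ℂ) * Complex.I) * ((ν : ℂ) * Complex.I) *
        Complex.exp ((ν : ℂ) * ((t : ℂ) * Complex.I))).re - C * 1) t :=
    fun t => ((hasDerivAt_const t (0 : ℝ)).sub (hasDerivAt_re_mul_cexp (β * ((ν : ℂ) * Complex.I)) ν t)).sub
      ((hasDerivAt_id' t).const_mul C)
  refine concaveOn_of_hasDerivWithinAt2_nonpos convex_univ
    (fun t _ => (hd1 t).continuousAt.continuousWithinAt)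
    (fun t _ => (hd1 t).hasDerivWithinAt) (fun t _ => (hd2 t).hasDerivWithinAt) ?_
  intro t _
  have h1 : β * ((ν : ℂ) * Complex.I) * ((ν : ℂ) * Complex.I) * Complex.exp ((ν : ℂ) * ((t : ℂ) * Complex.I)) =
      -(((ν ^ 2 : ℝ) : ℂ) * (β * Complex.exp ((ν : ℂ) * ((t : ℂ) * Complex.I)))) := by
    have hI : Complex.I * Complex.I = -1 := Complex.I_mul_I
    push_cast
    linear_combination (↑ν ^ 2 * β * Complex.exp ((ν : ℂ) * ((t : ℂ) * Complex.I))) * hI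
  have h2 : (β * Complex.exp ((ν : ℂ) * ((t : ℂ) * Complex.I))).re ≤ ‖β‖ := by
    refine (Complex.re_le_norm _).trans ?_
    rw [norm_mul, norm_cexp_slice, mul_one]
  rw [h1, Complex.neg_re, Complex.re_ofReal_mul]
  nlinarith [hC, h2, sq_nonneg ν]

/-! ## Concavity of one entry along a unimodular exponential path -/

/-- **Slice concavity of one entry of the symbol form:** if along the path `t ↦ z t` the phase monomial of the
class `c = (m, m', n)` is `e^{iνt} · P` with `|P| = 1`, then
`t ↦ Re cbil M (Δ_c(z t) a) (Δ_c(z t) a) − (C/2) t²` is concave whenever `ν² · absSum M · S ≤ C` for a bound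
`|aₘ|² + |aₘ'|² ≤ S`. [folklore] -/
theorem concaveOn_entry_of_phase (c : BondClass) (M : Mat) (a : Fin 2 → Fin 3 → ℂ) (z : ℝ → Fin 3 → ℂ)
    (P : ℂ) (ν C S : ℝ) (hP : ‖P‖ = 1)
    (hz : ∀ t, phase (z t) c.2.2 = Complex.exp ((ν : ℂ) * ((t : ℂ) * Complex.I)) * P)
    (hS : (∑ k, ‖a c.1 k‖ ^ 2) + ∑ k, ‖a c.2.1 k‖ ^ 2 ≤ S) (hC : ν ^ 2 * ((absSum M : ℝ) * S) ≤ C) :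
    ConcaveOn ℝ Set.univ
      (fun t : ℝ => (cbil M (blochDiff c (z t) a) (blochDiff c (z t) a)).re - C / 2 * t ^ 2) := by
  obtain ⟨m, m', n⟩ := c
  simp only at hz hS
  have hφ : ∀ t, ‖phase (z t) n‖ = 1 := fun t => by
    rw [hz t, norm_mul, norm_cexp_slice, hP, one_mul]
  have key : ∀ t : ℝ, (cbil M (blochDiff (m, m', n) (z t) a) (blochDiff (m, m', n) (z t) a)).re =
      (cbil M (a m') (a m') + cbil M (a m) (a m)).re -
        ((P * (conj (cbil M (a m') (a m)) + cbil M (a m) (a m'))) *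
          Complex.exp ((ν : ℂ) * ((t : ℂ) * Complex.I))).re := by
    intro t
    have hb : blochDiff (m, m', n) (z t) a = fun k => phase (z t) n * a m' k - a m k := rfl
    rw [hb, re_cbil_expand M (hφ t), hz t]
    congr 2
    ring
  simp only [key]
  refine concaveOn_model _ C ν _ ?_
  have hX := norm_cbil_le M (a m) (a m')
  have hY := norm_cbil_le M (a m') (a m)
  have hA : (0 : ℝ) ≤ absSum M := by exact_mod_cast absSum_nonneg M
  have hβ : ‖P * (conj (cbil M (a m') (a m)) + cbil M (a m) (a m'))‖ ≤ (absSum M : ℝ) * S := by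
    rw [norm_mul, hP, one_mul]
    refine (norm_add_le _ _).trans ?_
    rw [Complex.norm_conj]
    nlinarith [hX, hY, hS, hA]
  calc ν ^ 2 * ‖P * (conj (cbil M (a m') (a m)) + cbil M (a m) (a m'))‖
      ≤ ν ^ 2 * ((absSum M : ℝ) * S) := mul_le_mul_of_nonneg_left hβ (sq_nonneg ν)
    _ ≤ C := hC

end Summit.AtomisticToContinuum.Crystallization.Theorems.PhononStabilityCWC.Cert

end
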